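import Mathlib.Data.Fintype.BigOperators
import Mathlib.Data.Fintype.Pi
import Mathlib.Algebra.BigOperators.Ring.Finset
import Mathlib.Algebra.Order.BigOperators.Group.Finset
import HarnessLib

/-!
# `k`-wise independence fools adaptive readers of at most `k` cells

The counting lemma behind every "a `k`-wise independent input distribution is indistinguishable
from a uniformly random input by an algorithm that (adaptively) reads at most `k` input cells"
lower bound (sublinear-time algorithms, decision trees, local algorithms).

Setting. Inputs are points `x : ι → Bool` of a cube. A **stable reader** is a pair of a read-set
map `R : (ι → Bool) → Finset ι` and a predicate `A` on inputs (the event "the algorithm accepts")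
such that any input agreeing with `x` on `R x` has the same read set and the same verdict
(`IsStableReader`; this is exactly the shape of an adaptive decision tree: `R x` = the cells
queried along the path of `x` — for word-RAM programs it is supplied, coin stream by coin stream,
by `Literature.Computability.Cryptography.WordRAM.inputReadSet_congr` /
`outputsWithin_iff_of_inputReadSet`). A family of inputs `G : Y → (ι → Bool)` indexed by a finite
seed type is **`k`-wise uniform** if on every set of at most `k` cells every pattern is hit by
exactly a `2^{-|S|}` fraction of the seeds (`IsKWiseUniform`).

* `card_filter_agree_eq` — a cylinder over `|S|` cells has exactly `2^{|ι| - |S|}` points;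
* `IsStableReader.key`, `mem_cylinder_key_iff` — the cube is partitioned into the cylinders
  `{x' | x' agrees with x on R x}`, on each of which `R` and `A` are constant;
* **`IsStableReader.card_seeds_mul_eq`** — if every read set has at most `k` cells and `G` is
  `k`-wise uniform then `#{y | A (G y)} · 2^{|ι|} = #{x | A x} · |Y|`: the acceptance probability
  over a uniformly random member of the family equals that over a uniformly random input.

## References

* Folklore (e.g. the use of `k`-wise independent sample spaces against depth-`k` decision trees);
  N. Alon, L. Babai, A. Itai, *A fast and simple randomized parallel algorithm for the maximal
  independent set problem*, J. Algorithms 7 (1986), §§2–3 (k-wise independent sample spaces).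
-/

namespace Literature.Computability.Complexity

open Finset

variable {ι : Type*} [Fintype ι] [DecidableEq ι]

/-! ### Cylinders -/

/-- **A cylinder over `|S|` coordinates of `{0,1}^ι` has exactly `2^{|ι| - |S|}` points.** [folklore] -/
theorem card_filter_agree_eq (S : Finset ι) (z : ι → Bool) :
    #{x : ι → Bool | ∀ i ∈ S, x i = z i} = 2 ^ (Fintype.card ι - S.card) := by
  classical
  have hset : (univ.filter fun x : ι → Bool => ∀ i ∈ S, x i = z i) =
      Fintype.piFinset fun i => if i ∈ S then ({z i} : Finset Bool) else univ := by
    ext x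
    simp only [mem_filter, mem_univ, true_and, Fintype.mem_piFinset]
    constructor
    · intro h i
      by_cases hi : i ∈ S
      · simp [hi, h i hi]
      · simp [hi]
    · intro h i hi
      simpa [hi] using h i
  rw [hset, Fintype.card_piFinset]
  have : ∀ i, (if i ∈ S then ({z i} : Finset Bool) else univ).card = if i ∈ S then 1 else 2 := by
    intro i; split_ifs <;> simp
  simp_rw [this]
  rw [prod_ite, prod_const_one, one_mul, prod_const, filter_not, card_sdiff_of_subset
    (subset_univ _), card_univ, Finset.filter_mem_eq_inter, univ_inter]

/-! ### Stable readers -/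

/-- A **stable reader** on the cube `{0,1}^ι`: a read-set map `R` and a verdict `A` such that every
input agreeing with `x` on the cells `R x` is read in the same cells and receives the same verdict
(the adaptive-decision-tree property). [folklore] -/
structure IsStableReader (R : (ι → Bool) → Finset ι) (A : (ι → Bool) → Prop) : Prop where
  /-- Agreement on the read set forces the same read set. -/
  stable : ∀ x x' : ι → Bool, (∀ i ∈ R x, x' i = x i) → R x' = R x
  /-- Agreement on the read set forces the same verdict. -/
  determined : ∀ x x' : ι → Bool, (∀ i ∈ R x, x' i = x i) → (A x' ↔ A x)

/-- A family `G : Y → {0,1}^ι` of inputs indexed by a finite seed type is **`k`-wise uniform** if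
for every set `S` of at most `k` cells and every pattern `z`, exactly a `2^{-|S|}` fraction of the
seeds produce an input agreeing with `z` on `S`. [cite: AlonBabaiItai1986, §3 (k-wise independence)] -/
def IsKWiseUniform {Y : Type*} [Fintype Y] (k : ℕ) (G : Y → (ι → Bool)) : Prop :=
  ∀ (S : Finset ι), S.card ≤ k → ∀ z : ι → Bool,
    #{y : Y | ∀ i ∈ S, G y i = z i} * 2 ^ S.card = Fintype.card Y

/-- The identity family (a uniformly random input) is `k`-wise uniform for every `k`. [folklore] -/
theorem isKWiseUniform_id (k : ℕ) : IsKWiseUniform (ι := ι) k (id : (ι → Bool) → (ι → Bool)) := by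
  classical
  intro S _ z
  simp only [id, Fintype.card_pi, Fintype.card_bool, prod_const, card_univ]
  rw [card_filter_agree_eq, ← pow_add, Nat.sub_add_cancel (card_le_univ S)]

namespace IsStableReader

variable {R : (ι → Bool) → Finset ι} {A : (ι → Bool) → Prop}

/-- The masked input: `x` on `S`, `false` elsewhere — a canonical representative of the cylinder of
`x` over `S`. [folklore] -/
def mask (S : Finset ι) (x : ι → Bool) : ι → Bool := fun i => if i ∈ S then x i else false

omit [Fintype ι] in
/-- The masked input agrees with `x` on `S`. [folklore] -/
theorem mask_agree (S : Finset ι) (x : ι → Bool) : ∀ i ∈ S, mask S x i = x i := fun i hi => by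
  simp [mask, hi]

omit [Fintype ι] in
/-- Inputs agreeing on `S` have the same mask over `S`. [folklore] -/
theorem mask_congr {S : Finset ι} {x x' : ι → Bool} (h : ∀ i ∈ S, x' i = x i) :
    mask S x' = mask S x := by
  funext i
  by_cases hi : i ∈ S
  · simp [mask, hi, h i hi]
  · simp [mask, hi]

/-- The **key** of an input: its read set together with its masked restriction to it. Inputs with
the same key form the cylinder of `x` over `R x`. [folklore] -/
def key (_hR : IsStableReader R A) (x : ι → Bool) : Finset ι × (ι → Bool) := (R x, mask (R x) x)

omit [Fintype ι] in
/-- **The cylinders of the read sets partition the cube**: `x'` lies in the cylinder of `x` over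
`R x` iff `x'` and `x` have the same key. [folklore] -/
theorem mem_cylinder_key_iff (hR : IsStableReader R A) (x x' : ι → Bool) :
    (∀ i ∈ R x, x' i = x i) ↔ hR.key x' = hR.key x := by
  constructor
  · intro h
    have hRx : R x' = R x := hR.stable x x' h
    simp only [key, hRx, mask_congr h]
  · intro h
    have h1 : R x' = R x := congrArg Prod.fst h
    have h2 : mask (R x') x' = mask (R x) x := congrArg Prod.snd h
    intro i hi
    have := congrFun h2 i
    rw [h1] at this
    simpa [mask, hi] using this

omit [Fintype ι] in
/-- The masked representative of a key lies in its own cylinder, so the verdict at `x` is the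
verdict at the representative. [folklore] -/
theorem iff_rep (hR : IsStableReader R A) (x : ι → Bool) : A x ↔ A (mask (R x) x) :=
  (hR.determined x (mask (R x) x) (mask_agree (R x) x)).symm

omit [Fintype ι] in
/-- The read set at the masked representative is the read set. [folklore] -/
theorem readSet_rep (hR : IsStableReader R A) (x : ι → Bool) : R (mask (R x) x) = R x :=
  hR.stable x _ (mask_agree (R x) x)

/-- Counting a fibre of the key map inside a family: the seeds whose input has the key of `x` are
exactly the seeds whose input lies in the cylinder of `x`. [folklore] -/
theorem card_filter_key_eq {Y : Type*} [Fintype Y] [DecidablePred A] (hR : IsStableReader R A)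
    (G : Y → (ι → Bool)) (x : ι → Bool) :
    #{y : Y | A (G y) ∧ hR.key (G y) = hR.key x} =
      if A x then #{y : Y | ∀ i ∈ R x, G y i = x i} else 0 := by
  classical
  split_ifs with hx
  · congr 1
    ext y
    simp only [mem_filter, mem_univ, true_and]
    rw [← hR.mem_cylinder_key_iff x (G y)]
    exact ⟨fun h => h.2, fun h => ⟨(hR.determined x (G y) h).2 hx, h⟩⟩
  · rw [card_eq_zero, filter_eq_empty_iff]
    intro y _ ⟨hA, hk⟩
    exact hx ((hR.determined x (G y) ((hR.mem_cylinder_key_iff x (G y)).2 hk)).1 hA)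

/-- **`k`-wise uniform families fool stable readers of at most `k` cells.** If every read set has
at most `k` cells and `G : Y → {0,1}^ι` is `k`-wise uniform, then
`#{y | A (G y)} · 2^{|ι|} = #{x | A x} · |Y|` — the probability of the verdict over a uniformly
random member of the family equals that over a uniformly random input. [folklore] -/
theorem card_seeds_mul_eq {Y : Type*} [Fintype Y] [DecidablePred A] (hR : IsStableReader R A)
    {k : ℕ} (hk : ∀ x, (R x).card ≤ k) {G : Y → (ι → Bool)} (hG : IsKWiseUniform k G) :
    #{y : Y | A (G y)} * 2 ^ Fintype.card ι = #{x : ι → Bool | A x} * Fintype.card Y := by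
  classical
  -- the set of keys
  set K : Finset (Finset ι × (ι → Bool)) := univ.image hR.key with hK
  -- both counts, fibrewise over the keys
  have hY : #{y : Y | A (G y)} = ∑ κ ∈ K, #{y : Y | A (G y) ∧ hR.key (G y) = κ} := by
    rw [card_eq_sum_card_fiberwise (f := fun y => hR.key (G y)) (t := K)
      (fun y _ => by simp [hK])]
    refine sum_congr rfl fun κ _ => ?_
    congr 1; ext y; simp
  have hX : #{x : ι → Bool | A x} = ∑ κ ∈ K, #{x : ι → Bool | A x ∧ hR.key x = κ} := by
    rw [card_eq_sum_card_fiberwise (f := fun x => hR.key x) (t := K)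
      (fun x _ => by simp [hK])]
    refine sum_congr rfl fun κ _ => ?_
    congr 1; ext x; simp
  rw [hY, hX, sum_mul, sum_mul]
  refine sum_congr rfl fun κ hκ => ?_
  obtain ⟨x, -, rfl⟩ := mem_image.1 hκ
  -- the fibre over the key of `x`, in the family and in the cube (the identity family)
  rw [hR.card_filter_key_eq G x]
  have hid := (hR.card_filter_key_eq (id : (ι → Bool) → (ι → Bool)) x)
  simp only [id] at hid
  rw [hid]
  split_ifs with hx
  · -- `k`-wise uniformity on the read set of `x` (at most `k` cells) and the cylinder count
    have h1 := hG (R x) (hk x) x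
    have hle : (R x).card ≤ Fintype.card ι := card_le_univ _
    rw [card_filter_agree_eq (R x) x]
    calc #{y : Y | ∀ i ∈ R x, G y i = x i} * 2 ^ Fintype.card ι
        = #{y : Y | ∀ i ∈ R x, G y i = x i} * 2 ^ (R x).card *
            2 ^ (Fintype.card ι - (R x).card) := by
          rw [mul_assoc, ← pow_add, Nat.add_sub_cancel' hle]
      _ = Fintype.card Y * 2 ^ (Fintype.card ι - (R x).card) := by rw [h1]
      _ = 2 ^ (Fintype.card ι - (R x).card) * Fintype.card Y := mul_comm _ _
  · simp

end IsStableReader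

end Literature.Computability.Complexity
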